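import Literature.ModelTheory.Quasiminimal.ClassCategoricity
import HarnessLib

/-!
# Kirby 2010, Theorem 3.3 over the closure of a finite set: isomorphisms of closures extend

J. Kirby, *On quasiminimal excellent classes*, J. Symbolic Logic 75 (2010) 551–564, Thm 3.3:
*Let `𝒞` be a quasiminimal excellent class, `H, H' ∈ 𝒞`, `G ⊆ H` empty or closed and `f₀ : G → H'`
a closed embedding. Let `B` be a basis of `H` over `G` and `ψ_B` an injective partial map with
preimage `B` and image an independent set over `im f₀`. Then `ψ = f₀ ∪ ψ_B` extends to a closed
embedding `ψ̂ : H → H'`; if `im ψ` spans `H'` then `ψ̂` is an isomorphism.* ("If `G` is empty or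
finite dimensional then we may extend `G` to a closed subset of dimension `ℵ₀`, using theorem 2.1.")

`ClassCategoricity.lean` formalises the case `G = ∅` (`exists_equiv_extend_bases`, Haykazyan 2016
Thm 16) for Haykazyan's quasiminimal pregeometry classes, through the data `KirbyData` of Kirby's
proof (a basis `B ⊇ B₀ = range u`, a bijection `e` of bases, a closed embedding `f₀` of `cl B₀`)
and the compatible family `(f_X)` (`KirbyData.exists_goodFamily`). This file proves the case
**`G = cl I` for a finite independent `I`** and a closed embedding `f : G → H'` with closed image,
between two members of the same uncountable cardinality
(`IsQuasiminimalPregeometryClass.exists_equiv_extend_of_clIndep_finite`): following Kirby, `G` is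
enlarged to the closure of `B₀ = I ∪ {u₀, u₁, …}` (`uⱼ` independent over `G`) and `f` to a closed
embedding `f₀` of `cl B₀` by Thm 2.1 (`exists_isPartialEmbOn_extend_indepFamily`); the rest of
Kirby's proof is `KirbyData.exists_goodFamily` and the union of the `f_X` verbatim. It is the
statement behind Kirby–Macintyre–Onshuus 2012, §3.5 Proposition (automorphisms of finitely
generated strong partial E-subfields of a Zilber field extend), via `H = H' = F`.

Everything is proved; no named fact is introduced.

## References

* J. Kirby, *On quasiminimal excellent classes*, J. Symbolic Logic 75 (2010) 551–564,
  arXiv:0707.4496: Thm 2.1, Thm 3.3, Prop. 3.5.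
* L. Haykazyan, *Categoricity in quasiminimal pregeometry classes*, J. Symbolic Logic 81 (2016)
  56–64: Def. 2, Thm 16.
* J. Kirby, A. Macintyre, A. Onshuus, J. Inst. Math. Jussieu 11 (2012): §3.5 Proposition.
-/

noncomputable section

open Set
open FirstOrder FirstOrder.Language
open scoped Cardinal

universe u v w

namespace Literature.ModelTheory.Quasiminimal

namespace IsQuasiminimalPregeometryClass

variable {L : Language.{v, w}}
variable {𝒞 : ∀ (H : Type u) [L.Structure H], (Set H → Set H) → Prop}
variable {H H' : Type u} [L.Structure H] [L.Structure H'] {cl : Set H → Set H} {cl' : Set H' → Set H'}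

/-- In an uncountable member, a spanning set minus a countable set still has the cardinality of
the structure. [folklore] -/
theorem mk_diff_eq_of_cl_eq_univ [Uncountable H] (h : IsPregeometry cl)
    (hccp : ∀ A : Set H, A.Finite → (cl A).Countable) {B T : Set H} (hB : cl B = univ)
    (hTB : T ⊆ B) (hT : T.Countable) : #(B \ T : Set H) = #H := by
  have hBH : #B = #H := h.mk_eq_mk_of_cl_eq_univ hccp hB
  have hadd : #(B \ T : Set H) + #T = #B := Cardinal.mk_sdiff_add_mk hTB
  have hH : ℵ₀ < #H := Cardinal.aleph0_lt_mk
  have hTlt : #T < #B := by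
    rw [hBH]; exact lt_of_le_of_lt (Cardinal.mk_le_aleph0_iff.2 hT.to_subtype) hH
  rw [add_comm] at hadd
  rw [← hBH]
  exact Cardinal.eq_of_add_eq_of_aleph0_le hadd hTlt (by rw [hBH]; exact hH.le)

set_option maxHeartbeats 800000 in
/-- **Kirby 2010, Theorem 3.3 over the closure of a finite independent set, across two members of
the same uncountable cardinality.** Let `⟨H, cl⟩, ⟨H', cl'⟩` be members of a quasiminimal
pregeometry class with `#H = #H'` uncountable, `I ⊆ H` finite and independent, and `f` a partial
embedding on `G = cl I` whose image is closed. Then `f` extends to an isomorphism `H ≃[L] H'`.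
Proof (Kirby): choose a basis `B ⊇ I` of `H`, a sequence `u` in `B ∖ I` (so `I ∪ range u` is the
countable part `B₀` and `u` is independent over `G`), a basis `B' ⊇ f I` of `H'` and a sequence
`u'` in `B' ∖ f I`; extend `f ∪ (u ↦ u')` to a closed embedding `f₀` of `cl B₀` (Thm 2.1,
`exists_isPartialEmbOn_extend_indepFamily`), match the remaining basis elements by any bijection
`B ∖ B₀ ≃ B' ∖ (f I ∪ range u')` (equal cardinalities `#H = #H'`), and take the union of the
compatible family `(f_X)` of `KirbyData.exists_goodFamily` — it is an everywhere-defined partial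
embedding onto `H'` which is `f₀ ⊇ f` on `cl B₀ ⊇ G`.
[cite: Kirby2010QMEC, Thm 3.3] [cite: Haykazyan2016, Theorem 16] -/
theorem exists_equiv_extend_of_clIndep_finite (h𝒞 : IsQuasiminimalPregeometryClass L 𝒞)
    (hH : 𝒞 H cl) (hH' : 𝒞 H' cl') [Uncountable H] (hcard : #H = #H')
    {I : Set H} (hIfin : I.Finite) (hI : ClIndep cl I)
    {f : H → H'} (hf : IsPartialEmbOn L f (cl I)) (hfimg : cl' (f '' cl I) = f '' cl I) :
    ∃ Φ : H ≃[L] H', EqOn Φ f (cl I) := by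
  classical
  have hP := h𝒞.isPregeometry hH
  have hP' := h𝒞.isPregeometry hH'
  have hccp := h𝒞.countable_cl hH
  have hccp' := h𝒞.countable_cl hH'
  haveI : Uncountable H' := by
    rw [← Cardinal.aleph0_lt_mk_iff, ← hcard]; exact Cardinal.aleph0_lt_mk
  -- the closed set `G = cl I` and its image
  set G : Set H := cl I with hGdef
  have hG : cl G = G := hP.cl_cl I
  have hGc : G.Countable := hccp I hIfin
  have hIG : I ⊆ G := hP.subset_cl I
  have hfG : f '' G = cl' (f '' I) :=
    h𝒞.image_cl_eq_of_closed hH hH' hf hG hfimg hIG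
  have hG' : cl' (f '' G) = f '' G := hfimg
  -- a basis `B ⊇ I` of `H`
  obtain ⟨B, hBbase, hIB⟩ := (hP.indep_of_clIndep hI).exists_isBase_superset
  have hBind : ClIndep cl B := (hP.matroid_indep_iff).1 hBbase.indep
  have hBsp : cl B = univ := by
    have := hBbase.closure_eq; rwa [hP.matroid_closure, hP.matroid_E] at this
  -- `f I` is independent; a basis `B' ⊇ f I` of `H'`
  have hfinj : InjOn f G := hf.injOn
  have hfI : ClIndep cl' (f '' I) := by
    rintro _ ⟨x, hx, rfl⟩ hcl
    have himg : f '' I \ {f x} ⊆ f '' (I \ {x}) := by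
      rintro _ ⟨⟨y, hy, rfl⟩, hne⟩
      exact ⟨y, ⟨hy, fun hyx => hne (by rw [mem_singleton_iff.1 hyx]; exact mem_singleton _)⟩, rfl⟩
    have h1 : f x ∈ cl' (f '' (I \ {x})) := hP'.mono himg hcl
    have h2 : x ∈ cl (I \ {x}) :=
      (h𝒞.mem_cl_iff_mem_cl_image hH hH' hf (fun z hz => hIG hz.1) (hIG hx)).2 h1
    exact hI hx h2
  obtain ⟨B', hB'base, hIB'⟩ := (hP'.indep_of_clIndep hfI).exists_isBase_superset
  have hB'ind : ClIndep cl' B' := (hP'.matroid_indep_iff).1 hB'base.indep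
  have hB'sp : cl' B' = univ := by
    have := hB'base.closure_eq; rwa [hP'.matroid_closure, hP'.matroid_E] at this
  -- the sequences `u` in `B ∖ I` and `u'` in `B' ∖ f I`
  have hBIinf : (B \ I).Infinite := by
    intro hfin
    have hBfin : B.Finite := by
      have : B ⊆ (B \ I) ∪ I := fun b hb => by
        by_cases h : b ∈ I
        · exact Or.inr h
        · exact Or.inl ⟨hb, h⟩
      exact (hfin.union hIfin).subset this
    have : (univ : Set H).Countable := hBsp ▸ hccp B hBfin
    exact not_countable_univ this
  have hB'Iinf : (B' \ f '' I).Infinite := by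
    intro hfin
    have hB'fin : B'.Finite := by
      have : B' ⊆ (B' \ f '' I) ∪ f '' I := fun b hb => by
        by_cases h : b ∈ f '' I
        · exact Or.inr h
        · exact Or.inl ⟨hb, h⟩
      exact (hfin.union (hIfin.image f)).subset this
    have : (univ : Set H').Countable := hB'sp ▸ hccp' B' hB'fin
    exact not_countable_univ this
  haveI : Infinite (B \ I : Set H) := hBIinf.to_subtype
  haveI : Infinite (B' \ f '' I : Set H') := hB'Iinf.to_subtype
  let uB : ℕ ↪ (B \ I : Set H) := Infinite.natEmbedding _
  let uB' : ℕ ↪ (B' \ f '' I : Set H') := Infinite.natEmbedding _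
  let u : ℕ → H := fun j => (uB j : H)
  let u' : ℕ → H' := fun j => (uB' j : H')
  have hu_inj : Function.Injective u := Subtype.val_injective.comp uB.injective
  have hu'_inj : Function.Injective u' := Subtype.val_injective.comp uB'.injective
  have huB : ∀ j, u j ∈ B := fun j => (uB j).2.1
  have huI : ∀ j, u j ∉ I := fun j => (uB j).2.2
  have hu'B : ∀ j, u' j ∈ B' := fun j => (uB' j).2.1
  have hu'I : ∀ j, u' j ∉ f '' I := fun j => (uB' j).2.2
  -- they are independent over `G`, `f G`
  have hu : IndepFamilyOver cl G u := hBind.indepFamilyOver_cl hP hIB hu_inj huB huI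
  have hu' : IndepFamilyOver cl' (f '' G) u' := by
    rw [hfG]; exact hB'ind.indepFamilyOver_cl hP' hIB' hu'_inj hu'B hu'I
  -- Theorem 2.1: extend `f ∪ (u ↦ u')` to a closed embedding of `cl (G ∪ range u)`
  obtain ⟨F₀, hF₀, hF₀f, hF₀u, hF₀img⟩ := h𝒞.exists_isPartialEmbOn_extend_indepFamily hH hH' hGc
    (Or.inl ⟨hG, hG'⟩) hf hu hu'
  -- the countable part `B₀ = I ∪ range u`, enumerated
  obtain ⟨n, xs, hxs⟩ := hIfin.fin_embedding
  let uK : ℕ → H := KirbyData.interleave xs u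
  have hrange_uK : range uK = I ∪ range u := by
    rw [KirbyData.range_interleave, ← hxs]
  have huK_inj : Function.Injective uK := by
    refine KirbyData.interleave_injective xs.injective hu_inj fun i j h => ?_
    have : (xs i : H) ∈ I := by rw [← hxs]; exact ⟨i, rfl⟩
    exact huI j (h ▸ this)
  have huKB : ∀ j, uK j ∈ B := by
    intro j
    have : uK j ∈ range uK := ⟨j, rfl⟩
    rw [hrange_uK] at this
    rcases this with h | ⟨l, hl⟩
    · exact hIB h
    · exact hl ▸ huB l
  have hclB₀ : cl (range uK) = cl (G ∪ range u) := by
    rw [hrange_uK, hGdef, hP.cl_cl_union]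
  -- the remaining basis elements and a bijection between them
  set T : Set H := I ∪ range u with hTdef
  set T' : Set H' := f '' I ∪ range u' with hT'def
  have hTB : T ⊆ B := by
    rintro b (hb | ⟨j, rfl⟩)
    · exact hIB hb
    · exact huB j
  have hT'B' : T' ⊆ B' := by
    rintro b (hb | ⟨j, rfl⟩)
    · exact hIB' hb
    · exact hu'B j
  have hTc : T.Countable := hIfin.countable.union (countable_range u)
  have hT'c : T'.Countable := (hIfin.image f).countable.union (countable_range u')
  have hcardB₁ : #(B \ T : Set H) = #(B' \ T' : Set H') := by
    rw [mk_diff_eq_of_cl_eq_univ hP hccp hBsp hTB hTc,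
      mk_diff_eq_of_cl_eq_univ hP' hccp' hB'sp hT'B' hT'c, hcard]
  obtain ⟨ψ⟩ : Nonempty ((B \ T : Set H) ≃ (B' \ T' : Set H')) := Cardinal.eq.1 hcardB₁
  -- the bijection of bases: `ψ` on `B ∖ T`, `F₀` (i.e. `f` on `I`, `u ↦ u'`) on `T`
  let e : H → H' := fun z => if hz : z ∈ B \ T then (ψ ⟨z, hz⟩ : H') else F₀ z
  have he₁ : ∀ z (hz : z ∈ B \ T), e z = ψ ⟨z, hz⟩ := fun z hz => dif_pos hz
  have he₂ : ∀ z, z ∉ B \ T → e z = F₀ z := fun z hz => dif_neg hz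
  have hTsub : T ⊆ cl (G ∪ range u) := by
    rintro z (hz | hz)
    · exact hP.subset_cl _ (Or.inl (hIG hz))
    · exact hP.subset_cl _ (Or.inr hz)
  have hF₀I : ∀ z ∈ I, F₀ z = f z := fun z hz => hF₀f (hIG hz)
  have hF₀T : F₀ '' T = T' := by
    apply Subset.antisymm
    · rintro _ ⟨z, hz | ⟨j, rfl⟩, rfl⟩
      · exact Or.inl ⟨z, hz, (hF₀I z hz).symm⟩
      · exact Or.inr ⟨j, (hF₀u j).symm⟩
    · rintro y (⟨z, hz, rfl⟩ | ⟨j, rfl⟩)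
      · exact ⟨z, Or.inl hz, hF₀I z hz⟩
      · exact ⟨u j, Or.inr ⟨j, rfl⟩, hF₀u j⟩
  have heT : ∀ z ∈ T, e z = F₀ z := fun z hz => he₂ z fun h => h.2 hz
  have heB : ∀ b ∈ B, e b ∈ B' := by
    intro b hb
    by_cases hbT : b ∈ T
    · rw [heT b hbT]
      exact hT'B' (hF₀T.le ⟨b, hbT, rfl⟩)
    · rw [he₁ b ⟨hb, hbT⟩]
      exact (ψ ⟨b, ⟨hb, hbT⟩⟩).2.1
  have heinj : InjOn e B := by
    intro a ha b hb hab
    by_cases haT : a ∈ T <;> by_cases hbT : b ∈ T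
    · rw [heT a haT, heT b hbT] at hab
      exact hF₀.injOn (hTsub haT) (hTsub hbT) hab
    · exfalso
      rw [heT a haT, he₁ b ⟨hb, hbT⟩] at hab
      have h1 : F₀ a ∈ T' := hF₀T.le ⟨a, haT, rfl⟩
      rw [hab] at h1
      exact (ψ ⟨b, ⟨hb, hbT⟩⟩).2.2 h1
    · exfalso
      rw [he₁ a ⟨ha, haT⟩, heT b hbT] at hab
      have h1 : F₀ b ∈ T' := hF₀T.le ⟨b, hbT, rfl⟩
      rw [← hab] at h1
      exact (ψ ⟨a, ⟨ha, haT⟩⟩).2.2 h1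
    · rw [he₁ a ⟨ha, haT⟩, he₁ b ⟨hb, hbT⟩] at hab
      have := ψ.injective (Subtype.ext hab)
      exact congrArg Subtype.val this
  -- `e` is onto `B'`
  have hesurj : ∀ b' ∈ B', ∃ b ∈ B, e b = b' := by
    intro b' hb'
    by_cases hbT' : b' ∈ T'
    · obtain ⟨b, hbT, hbe⟩ := hF₀T.ge hbT'
      exact ⟨b, hTB hbT, by rw [heT b hbT, hbe]⟩
    · obtain ⟨⟨b, hb⟩, hbe⟩ := ψ.surjective ⟨b', ⟨hb', hbT'⟩⟩
      exact ⟨b, hb.1, by rw [he₁ b hb, hbe]⟩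
  -- Kirby's data
  have hf₀ : IsPartialEmbOn L F₀ (cl (range uK)) := by rw [hclB₀]; exact hF₀
  have hf₀img : F₀ '' cl (range uK) = cl' (e '' range uK) := by
    rw [hclB₀, hF₀img, hrange_uK]
    have : e '' T = T' := by
      rw [← hF₀T]
      exact image_congr fun z hz => heT z hz
    rw [this, hT'def, hfG, hP'.cl_cl_union]
  have hf₀e : ∀ j, F₀ (uK j) = e (uK j) := by
    intro j
    have : uK j ∈ T := by rw [← hrange_uK]; exact ⟨j, rfl⟩
    rw [heT _ this]
  let K : KirbyData L H H' cl cl' :=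
    ⟨B, B', e, uK, F₀, hBind, hB'ind, heB, heinj, huK_inj, huKB, hf₀, hf₀img, hf₀e⟩
  obtain ⟨𝔣, hgood, hcoh⟩ := K.exists_goodFamily h𝒞 hH hH'
  have hB₀ : K.B₀ = range uK := rfl
  have hB₀B : K.B₀ ⊆ B := by rw [hB₀]; rintro _ ⟨j, rfl⟩; exact huKB j
  -- finite supports (verbatim from `exists_equiv_extend_bases`)
  have hsupp : ∀ z : H, ∃ X : Finset H, ↑X ⊆ B ∧ Disjoint (↑X : Set H) K.B₀ ∧
      z ∈ cl (K.B₀ ∪ ↑X) := by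
    intro z
    have hz : z ∈ cl B := hBsp.symm ▸ mem_univ z
    obtain ⟨A, hAB, hAfin, hzA⟩ := hP.finite_character hz
    refine ⟨(hAfin.sdiff (t := K.B₀)).toFinset, ?_, ?_, ?_⟩
    · rw [Finite.coe_toFinset]; exact fun y hy => hAB hy.1
    · rw [Finite.coe_toFinset]; exact disjoint_sdiff_left
    · rw [Finite.coe_toFinset]
      refine hP.mono (fun y hy => ?_) hzA
      by_cases h : y ∈ K.B₀
      · exact Or.inl h
      · exact Or.inr ⟨hy, h⟩
  choose Xz hXzB hXzB₀ hzXz using hsupp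
  have hwd : ∀ (X X' : Finset H), ↑X ⊆ B → Disjoint (↑X : Set H) K.B₀ → ↑X' ⊆ B →
      Disjoint (↑X' : Set H) K.B₀ → ∀ z, z ∈ cl (K.B₀ ∪ ↑X) → z ∈ cl (K.B₀ ∪ ↑X') →
        𝔣 X z = 𝔣 X' z := by
    intro X X' hX hXd hX' hX'd z hz hz'
    have hU : (↑(X ∪ X') : Set H) ⊆ B ∧ Disjoint (↑(X ∪ X') : Set H) K.B₀ := by
      rw [Finset.coe_union]
      exact ⟨union_subset hX hX', disjoint_union_left.2 ⟨hXd, hX'd⟩⟩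
    rw [hcoh (X ∪ X') X hU.1 hU.2 Finset.subset_union_left hz,
      hcoh (X ∪ X') X' hU.1 hU.2 Finset.subset_union_right hz']
  let Φ : H → H' := fun z => 𝔣 (Xz z) z
  have hΦX : ∀ (X : Finset H), ↑X ⊆ B → Disjoint (↑X : Set H) K.B₀ → ∀ z ∈ cl (K.B₀ ∪ ↑X),
      Φ z = 𝔣 X z := fun X hX hXd z hz =>
    hwd _ _ (hXzB z) (hXzB₀ z) hX hXd z (hzXz z) hz
  -- `Φ` is a partial embedding everywhere
  have hΦ : IsPartialEmbOn L Φ univ := by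
    intro m t _
    let X : Finset H := Finset.univ.biUnion fun i => Xz (t i)
    have hXi : ∀ i, Xz (t i) ⊆ X := fun i => Finset.subset_biUnion_of_mem (fun i => Xz (t i))
      (Finset.mem_univ i)
    have hX : ↑X ⊆ B := by
      intro y hy
      obtain ⟨i, -, hi⟩ := Finset.mem_biUnion.1 (Finset.mem_coe.1 hy)
      exact hXzB (t i) hi
    have hXd : Disjoint (↑X : Set H) K.B₀ := by
      refine disjoint_left.2 fun y hy hyB₀ => ?_
      obtain ⟨i, -, hi⟩ := Finset.mem_biUnion.1 (Finset.mem_coe.1 hy)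
      exact (hXzB₀ (t i)).le_bot ⟨hi, hyB₀⟩
    have ht : ∀ i, t i ∈ cl (K.B₀ ∪ ↑X) := fun i =>
      hP.mono (union_subset_union_right _ (Finset.coe_subset.2 (hXi i))) (hzXz (t i))
    have e1 := (hgood X hX hXd).emb t ht
    have : Φ ∘ t = 𝔣 X ∘ t := funext fun i => hΦX X hX hXd _ (ht i)
    rw [this]
    exact e1
  -- `Φ` is onto
  have hΦsurj : Function.Surjective Φ := by
    intro y'
    have hy' : y' ∈ cl' B' := hB'sp.symm ▸ mem_univ y'
    obtain ⟨A', hA'B', hA'fin, hyA'⟩ := hP'.finite_character hy'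
    -- pull `A'` back to `B` along `e`
    have hpre : ∀ a' : A', ∃ a ∈ B, e a = a' := fun a' => hesurj a' (hA'B' a'.2)
    choose g hgB hge using hpre
    haveI : Fintype A' := hA'fin.fintype
    let A : Set H := range g
    have hAfin : A.Finite := finite_range g
    have hAB : A ⊆ B := by rintro _ ⟨a', rfl⟩; exact hgB a'
    have hA'A : A' ⊆ e '' A := fun a' ha' => ⟨g ⟨a', ha'⟩, ⟨⟨a', ha'⟩, rfl⟩, hge ⟨a', ha'⟩⟩
    let X : Finset H := (hAfin.sdiff (t := K.B₀)).toFinset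
    have hXcoe : (↑X : Set H) = A \ K.B₀ := Finite.coe_toFinset _
    have hX : ↑X ⊆ B := by rw [hXcoe]; exact fun y hy => hAB hy.1
    have hXd : Disjoint (↑X : Set H) K.B₀ := by rw [hXcoe]; exact disjoint_sdiff_left
    have hAX : A ⊆ K.B₀ ∪ ↑X := fun y hy => by
      rw [hXcoe]
      by_cases h : y ∈ K.B₀
      · exact Or.inl h
      · exact Or.inr ⟨hy, h⟩
    have hy'X : y' ∈ cl' (K.e '' (K.B₀ ∪ ↑X)) :=
      hP'.mono (hA'A.trans (image_mono hAX)) hyA'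
    rw [← (hgood X hX hXd).img] at hy'X
    obtain ⟨z, hz, rfl⟩ := hy'X
    exact ⟨z, hΦX X hX hXd z hz⟩
  have hΦbij : Function.Bijective Φ :=
    ⟨fun a c hac => hΦ.injOn (mem_univ a) (mem_univ c) hac, hΦsurj⟩
  refine ⟨hΦ.toEquiv hΦbij, fun z hz => ?_⟩
  show Φ z = f z
  -- on `G ⊆ cl B₀`, `Φ = 𝔣 ∅ = f₀ = F₀ = f`
  have hzcl : z ∈ cl (K.B₀ ∪ ↑(∅ : Finset H)) := by
    rw [Finset.coe_empty, union_empty, hB₀, hclB₀]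
    exact hP.mono subset_union_left (by rw [hG]; exact hz)
  have hzcl' : z ∈ cl K.B₀ := by rw [Finset.coe_empty, union_empty] at hzcl; exact hzcl
  rw [hΦX ∅ (by simp) (by simp) _ hzcl, (hgood ∅ (by simp) (by simp)).onB₀ hzcl']
  exact hF₀f hz

end IsQuasiminimalPregeometryClass

end Literature.ModelTheory.Quasiminimal
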